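import Literature.NumberTheory.PAdicHodge.FontaineThetaLocalField
import Mathlib.RingTheory.WittVector.Complete
import Mathlib.Topology.Algebra.Valued.NormedValued
import HarnessLib

/-!
# `ker θ = (ξ)`: the kernel of Fontaine's `θ : 𝔸_inf(F) → 𝒪_{ℂ_F}` is principal

For a nonarchimedean local field `F` of characteristic `0` and residue characteristic `p` we
construct

* `pRoot p n ∈ F̄` : a compatible system of `pⁿ`-th roots of `p` (`pRoot p (n+1)^p = pRoot p n`,
  `pRoot p 0 = p`), and `pRootC p n ∈ 𝒪_{ℂ_F}` its image;
* `pFlat : 𝒪_{ℂ_F}♭` : the element `p♭ = (p, p^{1/p}, p^{1/p²}, …) mod p` of the tilt, with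
  `(p♭)♯ = p` (`untilt_pFlat`);
* `xi = [p♭] − p ∈ 𝔸_inf(F)` with `θ(ξ) = 0` (`fontaineTheta_xi`);

and prove the structure theorem of Fontaine (Astérisque 223, Exp. II, §1.2.2–1.2.3;
Fontaine–Ouyang Prop. 4.4.3; Brinon–Conrad Prop. 4.4.3):

* `exists_eq_pFlat_mul_of_coeff_zero_eq_zero` : the kernel of `𝒪_{ℂ_F}♭ → 𝒪_{ℂ_F}/p`, `y ↦ y₀`,
  is `p♭·𝒪_{ℂ_F}♭`;
* `ker_fontaineTheta_eq_span_xi` : **`ker θ = ξ · 𝔸_inf(F)`**.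

The proof follows the printed one: `ker θ ⊆ ξ𝔸_inf + p·ker θ` (reduction mod `p` and the
previous point), iteration, and a `p`-adic limit in the `p`-adically complete ring `𝔸_inf`
(Mathlib `WittVector.isAdicCompleteIdealSpanP`), using that `ξ` is a non-zero-divisor modulo
every `pⁿ` (because `𝒪_{ℂ_F}♭` is a domain, Mathlib `PreTilt.isDomain`).

## References
* [FontaineAsterisque223III] J.-M. Fontaine, *Le corps des périodes p-adiques*, Astérisque 223
  (1994), Exp. II, §1.2.
* [FontaineOuyang2022] J.-M. Fontaine, Y. Ouyang, *Theory of p-adic Galois representations*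
  (book draft), Prop. 4.3.3, Prop. 4.4.3.
-/

noncomputable section

open ValuativeRel Field Ideal WittVector UniformSpace

namespace Literature.NumberTheory.PAdicHodge

open Literature.NumberTheory.GaloisRepresentations
open Literature.NumberTheory.GaloisRepresentations.IsNonarchimedeanLocalField

variable {F : Type} [Field F] [ValuativeRel F] [TopologicalSpace F] [IsNonarchimedeanLocalField F]
  {p : ℕ} [Fact p.Prime]

/-! ### Compatible `p`-power roots of `p` -/

variable (p) in
/-- **A compatible system of `pⁿ`-th roots of `p` in `F̄`**: `pRoot p 0 = p`,
`pRoot p (n+1)^p = pRoot p n` (roots exist since `F̄` is algebraically closed). [folklore] -/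
def pRoot : ℕ → NormedAlgClosure F
  | 0 => p
  | n + 1 => Classical.choose (IsAlgClosed.exists_pow_nat_eq (pRoot n) (Fact.out : p.Prime).pos)

/-- `pRoot p (n+1)^p = pRoot p n`. [folklore] -/
theorem pRoot_succ_pow (n : ℕ) : (pRoot p (n + 1) : NormedAlgClosure F) ^ p = pRoot p n :=
  Classical.choose_spec (IsAlgClosed.exists_pow_nat_eq (pRoot p n) (Fact.out : p.Prime).pos)

/-- `pRoot p n ^ pⁿ = p`. [folklore] -/
theorem pRoot_pow (n : ℕ) : (pRoot p n : NormedAlgClosure F) ^ p ^ n = p := by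
  induction n with
  | zero => rw [pow_zero, pow_one]; rfl
  | succ n ih => rw [pow_succ', pow_mul, pRoot_succ_pow, ih]

/-- `pRoot p n : ℂ_F`, raised to `pⁿ`, is `p`. [folklore] -/
theorem coe_pRoot_pow (n : ℕ) :
    ((pRoot p n : NormedAlgClosure F) : CompletedAlgClosure F) ^ p ^ n = (p : CompletedAlgClosure F) := by
  change (Completion.coeRingHom : NormedAlgClosure F →+* CompletedAlgClosure F) (pRoot p n) ^ p ^ n = _
  rw [← map_pow, pRoot_pow, map_natCast]

/-- `‖pRoot p n‖ ^ pⁿ = ‖p‖` (norms in `ℂ_F`). [folklore] -/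
theorem norm_coe_pRoot_pow (n : ℕ) :
    ‖((pRoot p n : NormedAlgClosure F) : CompletedAlgClosure F)‖ ^ p ^ n = ‖(p : CompletedAlgClosure F)‖ := by
  rw [← norm_pow, coe_pRoot_pow]

omit [Fact p.Prime] in
/-- `‖p‖ ≤ 1` in `ℂ_F`. [folklore] -/
theorem norm_natCast_C_le_one : ‖(p : CompletedAlgClosure F)‖ ≤ 1 := by
  rw [← coe_natCast_integerC]; exact norm_coe_integerC_le _

/-- `‖pRoot p n‖ ≤ 1`. [folklore] -/
theorem norm_coe_pRoot_le_one (n : ℕ) : ‖((pRoot p n : NormedAlgClosure F) : CompletedAlgClosure F)‖ ≤ 1 := by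
  by_contra h
  have h1 : 1 < ‖((pRoot p n : NormedAlgClosure F) : CompletedAlgClosure F)‖ ^ p ^ n :=
    one_lt_pow₀ (not_le.1 h) (pow_ne_zero _ (Fact.out : p.Prime).ne_zero)
  rw [norm_coe_pRoot_pow] at h1
  exact absurd norm_natCast_C_le_one (not_le.2 h1)

variable (p) in
/-- **`p^{1/pⁿ} ∈ 𝒪_{ℂ_F}`.** [folklore] -/
def pRootC (n : ℕ) : integerC F :=
  ⟨((pRoot p n : NormedAlgClosure F) : CompletedAlgClosure F), (mem_integerC_iff).2 (norm_coe_pRoot_le_one n)⟩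

/-- Unfolding of `pRootC`. [folklore] -/
theorem coe_pRootC (n : ℕ) :
    ((pRootC p n : integerC F) : CompletedAlgClosure F) = ((pRoot p n : NormedAlgClosure F) : CompletedAlgClosure F) := rfl

/-- `pRootC p (n+1)^p = pRootC p n`. [folklore] -/
theorem pRootC_succ_pow (n : ℕ) : (pRootC p (n + 1) : integerC F) ^ p = pRootC p n := by
  refine Subtype.ext ?_
  rw [SubmonoidClass.coe_pow, coe_pRootC, coe_pRootC]
  change (Completion.coeRingHom : NormedAlgClosure F →+* CompletedAlgClosure F) (pRoot p (n + 1)) ^ p =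
    (Completion.coeRingHom : NormedAlgClosure F →+* CompletedAlgClosure F) (pRoot p n)
  rw [← map_pow, pRoot_succ_pow]

/-- `pRootC p n ^ pⁿ = p`. [folklore] -/
theorem pRootC_pow (n : ℕ) : (pRootC p n : integerC F) ^ p ^ n = p := by
  refine Subtype.ext ?_
  rw [SubmonoidClass.coe_pow, coe_pRootC, coe_natCast_integerC, coe_pRoot_pow]

/-- `‖pRootC p n‖ ^ pⁿ = ‖p‖`. [folklore] -/
theorem norm_pRootC_pow (n : ℕ) :
    ‖((pRootC p n : integerC F) : CompletedAlgClosure F)‖ ^ p ^ n = ‖(p : CompletedAlgClosure F)‖ := by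
  rw [coe_pRootC, norm_coe_pRoot_pow]

section Tilt

variable [Fact (¬ IsUnit (p : integerC F))]

omit [Fact p.Prime] in
/-- `‖p‖ < 1` in `ℂ_F` (from `p ∉ 𝒪_{ℂ_F}ˣ`). [folklore] -/
theorem norm_natCast_C_lt_one' : ‖(p : CompletedAlgClosure F)‖ < 1 := by
  refine lt_of_le_of_ne norm_natCast_C_le_one fun h1 => (Fact.out : ¬ IsUnit (p : integerC F)) ?_
  have hp0 : (p : CompletedAlgClosure F) ≠ 0 := fun h0 => by rw [h0, norm_zero] at h1; exact zero_ne_one h1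
  refine ⟨⟨p, ⟨(p : CompletedAlgClosure F)⁻¹, ?_⟩, Subtype.ext ?_, Subtype.ext ?_⟩, rfl⟩
  · rw [mem_integerC_iff, norm_inv, h1, inv_one]
  · change (((p : integerC F)) : CompletedAlgClosure F) * (p : CompletedAlgClosure F)⁻¹ = 1
    rw [coe_natCast_integerC, mul_inv_cancel₀ hp0]
  · change (p : CompletedAlgClosure F)⁻¹ * (((p : integerC F)) : CompletedAlgClosure F) = 1
    rw [coe_natCast_integerC, inv_mul_cancel₀ hp0]

/-! ### The element `p♭` of the tilt -/

/-- **`p♭ = (p^{1/pⁿ} mod p)_n ∈ 𝒪_{ℂ_F}♭`.** [cite: FontaineAsterisque223III, Exp. II §1.2.2]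
[cite: FontaineOuyang2022, §4.3] -/
def pFlat : PreTilt (integerC F) p :=
  ⟨fun n => Ideal.Quotient.mk _ (pRootC p n), fun n => by rw [← map_pow, pRootC_succ_pow]⟩

/-- Coefficients of `p♭`. [folklore] -/
@[simp] theorem coeff_pFlat (n : ℕ) :
    PreTilt.coeff n (pFlat : PreTilt (integerC F) p) = Ideal.Quotient.mk _ (pRootC p n) := rfl

/-- `(p♭)₀ = 0` in `𝒪_{ℂ_F}/p`. [folklore] -/
theorem coeff_zero_pFlat : PreTilt.coeff 0 (pFlat : PreTilt (integerC F) p) = 0 := by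
  rw [coeff_pFlat, Ideal.Quotient.eq_zero_iff_mem]
  have h : (pRootC p 0 : integerC F) = p := by rw [← pRootC_pow (p := p) (F := F) 0, pow_zero, pow_one]
  rw [h]; exact Ideal.mem_span_singleton_self _

omit [Fact p.Prime] [Fact (¬ IsUnit (p : integerC F))] in
/-- `𝒪_{ℂ_F}` is the ring of integers of the norm valuation of `ℂ_F`. [folklore] -/
theorem integers_integerC :
    (NormedField.valuation (K := CompletedAlgClosure F)).Integers (integerC F) where
  hom_inj := Subtype.coe_injective
  map_le_one x := x.2
  exists_of_le_one r hr := ⟨⟨r, hr⟩, rfl⟩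

/-- **`𝒪_{ℂ_F}♭` is an integral domain** (Mathlib `PreTilt.isDomain` for the norm valuation of `ℂ_F`).
[cite: FontaineOuyang2022, Prop. 4.3.3] -/
instance instIsDomainPreTilt : IsDomain (PreTilt (integerC F) p) :=
  PreTilt.isDomain (CompletedAlgClosure F) NormedField.valuation (integerC F) integers_integerC p

/-! ### `ξ = [p♭] − p` -/

/-- **Fontaine's element `ξ = [p♭] − p ∈ 𝔸_inf(F)`.** [cite: FontaineAsterisque223III, Exp. II §1.2.2]
[cite: FontaineOuyang2022, Prop. 4.4.3] -/
def xi : Ainf (p := p) F := teichmuller p pFlat - (p : Ainf (p := p) F)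

/-- Unfolding of `ξ`. [folklore] -/
theorem xi_def : (xi : Ainf (p := p) F) = teichmuller p pFlat - (p : Ainf (p := p) F) := rfl

/-- `ξ mod p = p♭`: the constant Witt coefficient of `ξ`. [folklore] -/
theorem constantCoeff_xi : constantCoeff (xi : Ainf (p := p) F) = pFlat := by
  rw [xi_def, map_sub, constantCoeff_apply, teichmuller_coeff_zero, map_natCast, CharP.cast_eq_zero, sub_zero]

variable [IsAdicComplete (Ideal.span {(p : integerC F)}) (integerC F)]

/-- **`(p♭)♯ = p`.** [cite: FontaineAsterisque223III, Exp. II §1.2.2] -/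
theorem untilt_pFlat : PreTilt.untilt (pFlat : PreTilt (integerC F) p) = (p : integerC F) := by
  change Perfection.teichmuller p (Ideal.span {(p : integerC F)}) pFlat = _
  refine Perfection.teichmuller_spec fun n => ⟨pRootC p n, rfl, ?_⟩
  rw [pRootC_pow]
  exact SModEq.refl (M := integerC F) _

/-- **`θ(ξ) = 0`.** [cite: FontaineAsterisque223III, Exp. II §1.2.2] -/
theorem fontaineTheta_xi : fontaineTheta (integerC F) p (xi : Ainf (p := p) F) = 0 := by
  rw [xi_def, map_sub, fontaineTheta_teichmuller, untilt_pFlat, map_natCast, sub_self]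

/-- `ξ ∈ ker θ`. [folklore] -/
theorem xi_mem_ker : (xi : Ainf (p := p) F) ∈ RingHom.ker (fontaineTheta (integerC F) p) :=
  fontaineTheta_xi

/-! ### Compatible lifts `ỹ_n = (φ^{-n} y)♯` -/

/-- `ỹ_{n+1}^p = ỹ_n`. [folklore] -/
theorem untilt_frobeniusEquiv_symm_succ_pow (y : PreTilt (integerC F) p) (n : ℕ) :
    PreTilt.untilt (((frobeniusEquiv (PreTilt (integerC F) p) p).symm^[n + 1]) y) ^ p =
      PreTilt.untilt (((frobeniusEquiv (PreTilt (integerC F) p) p).symm^[n]) y) := by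
  rw [← map_pow, Function.iterate_succ_apply', ← frobenius_def, frobenius_apply_frobeniusEquiv_symm]

/-- `ỹ_n mod p = y_n`. [folklore] -/
theorem mk_untilt_frobeniusEquiv_symm (y : PreTilt (integerC F) p) (n : ℕ) :
    Ideal.Quotient.mk (Ideal.span {(p : integerC F)})
        (PreTilt.untilt (((frobeniusEquiv (PreTilt (integerC F) p) p).symm^[n]) y)) = PreTilt.coeff n y := by
  rw [PreTilt.mk_untilt_eq_coeff_zero, PreTilt.coeff_iterate_frobeniusEquiv_symm, zero_add]

/-- `‖ỹ_n‖ ^ pⁿ = ‖y♯‖`. [folklore] -/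
theorem norm_untilt_frobeniusEquiv_symm_pow (y : PreTilt (integerC F) p) (n : ℕ) :
    ‖((PreTilt.untilt (((frobeniusEquiv (PreTilt (integerC F) p) p).symm^[n]) y) : integerC F) : CompletedAlgClosure F)‖ ^ p ^ n =
      ‖((PreTilt.untilt y : integerC F) : CompletedAlgClosure F)‖ := by
  rw [← norm_pow, ← SubmonoidClass.coe_pow, PreTilt.untilt_iterate_frobeniusEquiv_symm_pow]

/-- If `y₀ = 0` then `‖y♯‖ ≤ ‖p‖`. [folklore] -/
theorem norm_untilt_le_of_coeff_zero_eq_zero {y : PreTilt (integerC F) p} (hy : PreTilt.coeff 0 y = 0) :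
    ‖((PreTilt.untilt y : integerC F) : CompletedAlgClosure F)‖ ≤ ‖(p : CompletedAlgClosure F)‖ := by
  have h : Ideal.Quotient.mk (Ideal.span {(p : integerC F)}) (PreTilt.untilt y) = 0 := by
    rw [PreTilt.mk_untilt_eq_coeff_zero]; exact hy
  rw [Ideal.Quotient.eq_zero_iff_mem, Ideal.mem_span_singleton] at h
  obtain ⟨c, hc⟩ := h
  rw [hc, Subring.coe_mul, coe_natCast_integerC, norm_mul]
  exact mul_le_of_le_one_right (norm_nonneg _) (norm_coe_integerC_le c)

/-! ### Characteristic zero: `p ≠ 0` in `ℂ_F`, `p♭ ≠ 0`, and the division `y / p♭` -/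

variable [CharZero F]

omit [Fact (¬ IsUnit (p : integerC F))] [IsAdicComplete (Ideal.span {(p : integerC F)}) (integerC F)] in
/-- `pRootC p n ≠ 0` in `ℂ_F`. [folklore] -/
theorem coe_pRootC_ne_zero (n : ℕ) : ((pRootC p n : integerC F) : CompletedAlgClosure F) ≠ 0 := by
  intro h
  have h1 := norm_pRootC_pow (p := p) (F := F) n
  rw [h, norm_zero, zero_pow (pow_ne_zero _ (Fact.out : p.Prime).ne_zero)] at h1
  exact norm_ne_zero_iff.2 (natCast_C_ne_zero (F := F) (Fact.out : p.Prime).ne_zero) h1.symm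

omit [Fact (¬ IsUnit (p : integerC F))] [IsAdicComplete (Ideal.span {(p : integerC F)}) (integerC F)] in
/-- `𝒪_{ℂ_F}` has no `p`-torsion. [folklore] -/
theorem eq_zero_of_natCast_mul_eq_zero {a : integerC F} (h : (p : integerC F) * a = 0) : a = 0 := by
  rcases mul_eq_zero.1 h with h0 | h0
  · exact absurd (congrArg Subtype.val h0 : ((p : integerC F) : CompletedAlgClosure F) = 0)
      (by rw [coe_natCast_integerC]; exact natCast_C_ne_zero (Fact.out : p.Prime).ne_zero)
  · exact h0

omit [IsAdicComplete (Ideal.span {(p : integerC F)}) (integerC F)] in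
/-- **`p♭ ≠ 0`** (its first coefficient `p^{1/p} mod p` is nonzero because `‖p^{1/p}‖ > ‖p‖`). [folklore] -/
theorem pFlat_ne_zero : (pFlat : PreTilt (integerC F) p) ≠ 0 := by
  have hp := (Fact.out : p.Prime)
  intro h
  have h1 : PreTilt.coeff 1 (pFlat : PreTilt (integerC F) p) = 0 := by rw [h, map_zero]
  rw [coeff_pFlat, Ideal.Quotient.eq_zero_iff_mem, Ideal.mem_span_singleton] at h1
  obtain ⟨c, hc⟩ := h1
  have h2 : ‖((pRootC p 1 : integerC F) : CompletedAlgClosure F)‖ ≤ ‖(p : CompletedAlgClosure F)‖ := by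
    rw [hc, Subring.coe_mul, coe_natCast_integerC, norm_mul]
    exact mul_le_of_le_one_right (norm_nonneg _) (norm_coe_integerC_le c)
  have h3 := norm_pRootC_pow (p := p) (F := F) 1
  rw [pow_one] at h3
  have hlt : ‖(p : CompletedAlgClosure F)‖ < 1 := norm_natCast_C_lt_one'
  have hpos : 0 < ‖((pRootC p 1 : integerC F) : CompletedAlgClosure F)‖ := norm_pos_iff.2 (coe_pRootC_ne_zero 1)
  have h4 : ‖((pRootC p 1 : integerC F) : CompletedAlgClosure F)‖ ^ p <
      ‖((pRootC p 1 : integerC F) : CompletedAlgClosure F)‖ :=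
    pow_lt_self_of_lt_one₀ hpos (h2.trans_lt hlt) hp.one_lt
  rw [h3] at h4
  exact absurd h2 (not_le.2 h4)

omit [IsAdicComplete (Ideal.span {(p : integerC F)}) (integerC F)] in
/-- `p♭` is a non-zero-divisor of `𝒪_{ℂ_F}♭`. [folklore] -/
theorem eq_zero_of_pFlat_mul_eq_zero {c : PreTilt (integerC F) p} (h : pFlat * c = 0) : c = 0 :=
  (mul_eq_zero.1 h).resolve_left pFlat_ne_zero

/-- The quotients `z̃_n = ỹ_n / p^{1/pⁿ}` lie in `𝒪_{ℂ_F}` when `y₀ = 0`. [folklore] -/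
theorem norm_untilt_div_pRootC_le_one {y : PreTilt (integerC F) p} (hy : PreTilt.coeff 0 y = 0) (n : ℕ) :
    ‖((PreTilt.untilt (((frobeniusEquiv (PreTilt (integerC F) p) p).symm^[n]) y) : integerC F) : CompletedAlgClosure F) /
        ((pRootC p n : integerC F) : CompletedAlgClosure F)‖ ≤ 1 := by
  have hp0 : p ^ n ≠ 0 := pow_ne_zero _ (Fact.out : p.Prime).ne_zero
  rw [norm_div, div_le_one (norm_pos_iff.2 (coe_pRootC_ne_zero n))]
  refine le_of_pow_le_pow_left₀ hp0 (norm_nonneg _) ?_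
  rw [norm_untilt_frobeniusEquiv_symm_pow, norm_pRootC_pow]
  exact norm_untilt_le_of_coeff_zero_eq_zero hy

/-- The compatible sequence `z̃_n = ỹ_n / p^{1/pⁿ} ∈ 𝒪_{ℂ_F}`. [folklore] -/
def divSeq (y : PreTilt (integerC F) p) (hy : PreTilt.coeff 0 y = 0) (n : ℕ) : integerC F :=
  ⟨((PreTilt.untilt (((frobeniusEquiv (PreTilt (integerC F) p) p).symm^[n]) y) : integerC F) : CompletedAlgClosure F) /
      ((pRootC p n : integerC F) : CompletedAlgClosure F),
    (mem_integerC_iff).2 (norm_untilt_div_pRootC_le_one hy n)⟩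

/-- Unfolding of `divSeq`. [folklore] -/
theorem coe_divSeq (y : PreTilt (integerC F) p) (hy : PreTilt.coeff 0 y = 0) (n : ℕ) :
    ((divSeq y hy n : integerC F) : CompletedAlgClosure F) =
      ((PreTilt.untilt (((frobeniusEquiv (PreTilt (integerC F) p) p).symm^[n]) y) : integerC F) : CompletedAlgClosure F) /
        ((pRootC p n : integerC F) : CompletedAlgClosure F) := rfl

/-- `z̃_{n+1}^p = z̃_n`. [folklore] -/
theorem divSeq_succ_pow (y : PreTilt (integerC F) p) (hy : PreTilt.coeff 0 y = 0) (n : ℕ) :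
    divSeq y hy (n + 1) ^ p = divSeq y hy n := by
  refine Subtype.ext ?_
  rw [SubmonoidClass.coe_pow, coe_divSeq, coe_divSeq, div_pow, ← SubmonoidClass.coe_pow, ← SubmonoidClass.coe_pow,
    untilt_frobeniusEquiv_symm_succ_pow, pRootC_succ_pow]

/-- `p^{1/pⁿ} · z̃_n = ỹ_n`. [folklore] -/
theorem pRootC_mul_divSeq (y : PreTilt (integerC F) p) (hy : PreTilt.coeff 0 y = 0) (n : ℕ) :
    pRootC p n * divSeq y hy n = PreTilt.untilt (((frobeniusEquiv (PreTilt (integerC F) p) p).symm^[n]) y) := by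
  refine Subtype.ext ?_
  rw [Subring.coe_mul, coe_divSeq, mul_div_cancel₀ _ (coe_pRootC_ne_zero n)]

/-- **The element `y / p♭` of the tilt**, for `y` with `y₀ = 0`. [folklore] -/
def divPFlat (y : PreTilt (integerC F) p) (hy : PreTilt.coeff 0 y = 0) : PreTilt (integerC F) p :=
  ⟨fun n => Ideal.Quotient.mk _ (divSeq y hy n), fun n => by rw [← map_pow, divSeq_succ_pow]⟩

/-- Coefficients of `y / p♭`. [folklore] -/
theorem coeff_divPFlat (y : PreTilt (integerC F) p) (hy : PreTilt.coeff 0 y = 0) (n : ℕ) :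
    PreTilt.coeff n (divPFlat y hy) = Ideal.Quotient.mk _ (divSeq y hy n) := rfl

/-- `p♭ · (y / p♭) = y`. [folklore] -/
theorem pFlat_mul_divPFlat (y : PreTilt (integerC F) p) (hy : PreTilt.coeff 0 y = 0) :
    pFlat * divPFlat y hy = y := by
  refine Perfection.ext fun n => ?_
  change PreTilt.coeff n (pFlat * divPFlat y hy) = PreTilt.coeff n y
  rw [map_mul, coeff_pFlat, coeff_divPFlat, ← map_mul, pRootC_mul_divSeq, mk_untilt_frobeniusEquiv_symm]

/-- **The kernel of `𝒪_{ℂ_F}♭ → 𝒪_{ℂ_F}/p`, `y ↦ y₀`, is `p♭ · 𝒪_{ℂ_F}♭`.**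
[cite: FontaineAsterisque223III, Exp. II §1.2.2] [cite: FontaineOuyang2022, Prop. 4.3.3] -/
theorem exists_eq_pFlat_mul_of_coeff_zero_eq_zero {y : PreTilt (integerC F) p} (hy : PreTilt.coeff 0 y = 0) :
    ∃ z : PreTilt (integerC F) p, y = pFlat * z :=
  ⟨divPFlat y hy, (pFlat_mul_divPFlat y hy).symm⟩

/-! ### `ker θ = (ξ)` -/

/-- **One step: `ker θ ⊆ ξ·𝔸_inf + p·ker θ`.** For `x ∈ ker θ`, `x₀ ∈ 𝒪_{ℂ_F}♭` has `(x₀)₀ = θ(x) mod p = 0`,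
so `x₀ = p♭ z`; then `x − [p♭][z] ∈ p𝔸_inf`, i.e. `x = ξ[z] + p·w`, and `p θ(w) = 0` forces `θ(w) = 0`.
[cite: FontaineOuyang2022, Prop. 4.4.3] -/
theorem exists_eq_xi_mul_add_p_mul {x : Ainf (p := p) F} (hx : x ∈ RingHom.ker (fontaineTheta (integerC F) p)) :
    ∃ a w : Ainf (p := p) F, w ∈ RingHom.ker (fontaineTheta (integerC F) p) ∧ x = xi * a + (p : Ainf (p := p) F) * w := by
  rw [RingHom.mem_ker] at hx
  have h0 : PreTilt.coeff 0 (x.coeff 0) = 0 := by rw [← mk_fontaineTheta, hx, map_zero]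
  obtain ⟨z, hz⟩ := exists_eq_pFlat_mul_of_coeff_zero_eq_zero h0
  have h1 : (x - teichmuller p pFlat * teichmuller p z).coeff 0 = 0 := by
    rw [← constantCoeff_apply, map_sub, map_mul, constantCoeff_apply, constantCoeff_apply,
      constantCoeff_apply, teichmuller_coeff_zero, teichmuller_coeff_zero, hz, sub_self]
  rw [← mem_span_p_iff_coeff_zero_eq_zero, Ideal.mem_span_singleton'] at h1
  obtain ⟨b, hb⟩ := h1
  have hxeq : x = xi * teichmuller p z + (p : Ainf (p := p) F) * (teichmuller p z + b) := by
    rw [xi_def]; linear_combination -hb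
  refine ⟨teichmuller p z, teichmuller p z + b, ?_, hxeq⟩
  rw [RingHom.mem_ker]
  have h2 : fontaineTheta (integerC F) p x =
      fontaineTheta (integerC F) p xi * fontaineTheta (integerC F) p (teichmuller p z) +
        (p : integerC F) * fontaineTheta (integerC F) p (teichmuller p z + b) := by
    rw [← map_natCast (fontaineTheta (integerC F) p) p, ← map_mul, ← map_mul, ← map_add, ← hxeq]
  rw [hx, fontaineTheta_xi, zero_mul, zero_add] at h2
  exact eq_zero_of_natCast_mul_eq_zero h2.symm

/-- Iteration: `ker θ ⊆ ξ·𝔸_inf + pⁿ·ker θ` for every `n`. [cite: FontaineOuyang2022, Prop. 4.4.3] -/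
theorem exists_eq_xi_mul_add_p_pow_mul (n : ℕ) {x : Ainf (p := p) F} (hx : x ∈ RingHom.ker (fontaineTheta (integerC F) p)) :
    ∃ a w : Ainf (p := p) F, w ∈ RingHom.ker (fontaineTheta (integerC F) p) ∧ x = xi * a + (p : Ainf (p := p) F) ^ n * w := by
  induction n with
  | zero => exact ⟨0, x, hx, by rw [mul_zero, zero_add, pow_zero, one_mul]⟩
  | succ n ih =>
    obtain ⟨a, w, hw, hxw⟩ := ih
    obtain ⟨a', w', hw', hww⟩ := exists_eq_xi_mul_add_p_mul hw
    refine ⟨a + (p : Ainf (p := p) F) ^ n * a', w', hw', ?_⟩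
    rw [hxw, hww]; ring

omit [IsAdicComplete (Ideal.span {(p : integerC F)}) (integerC F)] in
/-- **`ξ` is a non-zero-divisor modulo `pⁿ`**: `ξ c ∈ pⁿ𝔸_inf ⇒ c ∈ pⁿ𝔸_inf`. [cite: FontaineOuyang2022, Prop. 4.4.3] -/
theorem mem_span_p_pow_of_xi_mul_mem (n : ℕ) : ∀ {c : Ainf (p := p) F},
    xi * c ∈ Ideal.span {((p : Ainf (p := p) F)) ^ n} → c ∈ Ideal.span {((p : Ainf (p := p) F)) ^ n} := by
  induction n with
  | zero => intro c _; rw [pow_zero, Ideal.span_singleton_one]; exact Submodule.mem_top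
  | succ n ih =>
    intro c hc
    rw [Ideal.mem_span_singleton'] at hc
    obtain ⟨d, hd⟩ := hc
    -- reduce mod p: p♭ c₀ = 0, so c₀ = 0 and c = c' p
    have h0 : c.coeff 0 = 0 := by
      have h1 : constantCoeff (xi * c) = constantCoeff (d * (p : Ainf (p := p) F) ^ (n + 1)) := by rw [hd]
      rw [map_mul, constantCoeff_xi, map_mul, map_pow, map_natCast, CharP.cast_eq_zero,
        zero_pow (Nat.succ_ne_zero n), mul_zero, constantCoeff_apply] at h1
      exact eq_zero_of_pFlat_mul_eq_zero h1
    rw [← mem_span_p_iff_coeff_zero_eq_zero, Ideal.mem_span_singleton'] at h0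
    obtain ⟨c', rfl⟩ := h0
    -- cancel p
    have h2 : xi * c' = d * (p : Ainf (p := p) F) ^ n := by
      refine sub_eq_zero.1 (eq_zero_of_p_mul_eq_zero _ ?_)
      rw [sub_mul, mul_assoc, ← hd]; ring
    have h3 : c' ∈ Ideal.span {((p : Ainf (p := p) F)) ^ n} := ih (Ideal.mem_span_singleton'.2 ⟨d, h2.symm⟩)
    obtain ⟨e, he⟩ := Ideal.mem_span_singleton'.1 h3
    exact Ideal.mem_span_singleton'.2 ⟨e, by rw [pow_succ, ← mul_assoc, he]⟩

/-- **`ker θ = ξ · 𝔸_inf(F)`** (Fontaine). Given `x ∈ ker θ`, write `x = ξ aₙ + pⁿ wₙ`; then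
`ξ(aₙ − aₘ) ∈ p^m 𝔸_inf` forces `aₙ − aₘ ∈ p^m 𝔸_inf`, so `(aₙ)` converges `p`-adically to some `a`
(Mathlib: `𝕎` of a perfect ring is `p`-adically complete) and `x − ξa ∈ ⋂ pⁿ𝔸_inf = 0`.
[cite: FontaineAsterisque223III, Exp. II Prop. 1.2.3] [cite: FontaineOuyang2022, Prop. 4.4.3] -/
theorem ker_fontaineTheta_eq_span_xi :
    RingHom.ker (fontaineTheta (integerC F) p) = Ideal.span {(xi : Ainf (p := p) F)} := by
  refine le_antisymm (fun x hx => ?_) ?_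
  · choose a w _hw hxa using fun n => exists_eq_xi_mul_add_p_pow_mul n hx
    have hxa' : ∀ n, x - xi * a n ∈ Ideal.span {((p : Ainf (p := p) F)) ^ n} := fun n =>
      Ideal.mem_span_singleton'.2 ⟨w n, by rw [hxa n]; ring⟩
    have hcauchy : ∀ {m n : ℕ}, m ≤ n → a m ≡ a n [SMOD (Ideal.span {(p : Ainf (p := p) F)} ^ m • ⊤ :
        Submodule (Ainf (p := p) F) (Ainf (p := p) F))] := by
      intro m n hmn
      rw [smul_eq_mul, Ideal.mul_top, Ideal.span_singleton_pow, SModEq.sub_mem]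
      have h1 : xi * (a m - a n) ∈ Ideal.span {((p : Ainf (p := p) F)) ^ m} := by
        have : xi * (a m - a n) = (x - xi * a n) - (x - xi * a m) := by ring
        rw [this]
        exact Submodule.sub_mem _ (Ideal.span_singleton_le_span_singleton.2 (pow_dvd_pow _ hmn) (hxa' n)) (hxa' m)
      exact mem_span_p_pow_of_xi_mul_mem m h1
    obtain ⟨L, hL⟩ := IsPrecomplete.prec (IsAdicComplete.toIsPrecomplete (I := Ideal.span {(p : Ainf (p := p) F)})) hcauchy
    have hxL : x - xi * L = 0 := by
      refine IsHausdorff.haus (IsAdicComplete.toIsHausdorff (I := Ideal.span {(p : Ainf (p := p) F)})) _ fun n => ?_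
      have hn := hL n
      rw [smul_eq_mul, Ideal.mul_top, Ideal.span_singleton_pow] at hn ⊢
      rw [SModEq.zero]
      rw [SModEq.sub_mem] at hn
      have : x - xi * L = (x - xi * a n) + xi * (a n - L) := by ring
      rw [this]
      exact Submodule.add_mem _ (hxa' n) (Ideal.mul_mem_left _ _ hn)
    rw [sub_eq_zero] at hxL
    exact Ideal.mem_span_singleton'.2 ⟨L, by rw [hxL, mul_comm]⟩
  · rw [Ideal.span_le, Set.singleton_subset_iff]
    exact xi_mem_ker

/-- Every element of `ker θ` is a multiple of `ξ`. [cite: FontaineAsterisque223III, Exp. II Prop. 1.2.3] -/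
theorem xi_dvd_of_fontaineTheta_eq_zero {x : Ainf (p := p) F} (hx : fontaineTheta (integerC F) p x = 0) :
    (xi : Ainf (p := p) F) ∣ x := by
  rw [← Ideal.mem_span_singleton, ← ker_fontaineTheta_eq_span_xi]; exact hx

end Tilt

end Literature.NumberTheory.PAdicHodge

end
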